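import Literature.NumberTheory.Automorphic.QuaternionAlgebraAdelicProofs
import Literature.NumberTheory.Automorphic.AdicCompletionCompact
import Literature.NumberTheory.Automorphic.AdeleRingTopology
import HarnessLib

/-!
# The classical inputs of Fujisaki's lemma — discharges for `QuaternionAlgebraAdelicProofs`

Second sibling proof file of `Literature.NumberTheory.Automorphic.QuaternionAlgebraAdelic` (namespace
`Literature.Automorphic`). `QuaternionAlgebraAdelicProofs` reduced Fujisaki's compactness theorem
(`AdelicGroupData.compactSpace_automorphicQuotient_units`) to five classical inputs, vendored there
as named facts; this file proves, sorry-free, four of them, for *every* finite-dimensional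
`K`-algebra `D` over the number field `K`:

* `compactSpace_adicCompletionIntegers K` — the local integer rings `𝒪_v` are compact
  (`compactSpace_adicCompletionIntegers_holds`, from `AdicCompletionCompact`);
* `discreteTopology_rationalLattice K D` and `compactSpace_quotient_rationalLattice K D` — Weil's
  Thm. IV.2: `D` is discrete and cocompact in `D_𝔸 = 𝔸_K ⊗_K D`
  (`discreteTopology_rationalLattice_holds`, `compactSpace_quotient_rationalLattice_holds`): by
  Weil's own reduction ("E is isomorphic to `kⁿ`, so that, if the theorem is proved for `E = k`, it
  must be true in general") from the case `E = k` proved in `AdeleRingTopology`, using the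
  coordinates `D_𝔸 ≅ 𝔸_Kⁿ`, `D ≅ Kⁿ` of `ScalarExtension.coordLinearEquiv`
  (`ScalarExtension.coordLinearEquiv_incl`);
* `addHaar_posRealCentral_smul K D` — the module of the central real scalar `t > 0` on `D_𝔸` is
  `t ^ ([K:ℚ] · dim_K D)` (`addHaar_posRealCentral_smul_holds`; Weil IV §4, Cor. 2 of Thm. 5):
  the module of the diagonal idele `z(t)` acting coordinatewise on `𝔸_Kⁿ` is `t ^ (n [K:ℚ])`
  (`AdeleRing.distribHaarChar_pi_posRealIdele`, the `n`-dimensional version of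
  `AdeleRing.distribHaarChar_posRealIdele` of `AdeleRingTopology`, same slicing proof), and modules
  are invariant under equivariant isomorphisms of locally compact groups
  (`distribHaarChar_eq_of_continuousAddEquiv`).

The fifth input, `addHaar_units_smul_eq_op_smul K D` (equality of the modules of left and right
multiplication on `D_𝔸ˣ` for central simple `D`; Vignéras II §4 "module commun"), remains a named
fact; for `D = K` it is trivial (commutativity) — see `AdelicGroupDataProofs`.

## References

* A. Weil, *Basic Number Theory* (1967), Ch. IV §1; §2, Thm. 2; §4, Cor. 2 of Thm. 5. [WeilBNT1967]
* M.-F. Vignéras, *Arithmétique des algèbres de quaternions*, LNM 800 (1980), Ch. II §4, Ch. III §1.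
  [VignerasLNM800]
-/

noncomputable section

open NumberField InfinitePlace IsDedekindDomain MeasureTheory Measure Topology
open scoped TensorProduct NNReal ENNReal Pointwise

namespace Literature.NumberTheory.Automorphic

/-! ### Input 1: the local integer rings are compact -/

section InputOne

variable (K : Type) [Field K] [NumberField K]

/-- Discharge of the named fact `compactSpace_adicCompletionIntegers` (every `𝒪_v` is compact), by
`compactSpace_adicCompletionIntegers'` of `AdicCompletionCompact` (finite residue field + complete
DVR, Mathlib's compactness criterion). Weil, BNT Ch. III §1 with Ch. I §4.
[cite: WeilBNT1967, Ch. III §1 (completions of an A-field at finite places are p-fields) with Ch. I §4 Thm. 6] -/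
theorem compactSpace_adicCompletionIntegers_holds : compactSpace_adicCompletionIntegers K :=
  compactSpace_adicCompletionIntegers' K

end InputOne

/-! ### Coordinates of the lattice `D ⊆ D_𝔸` -/

section Coordinates

variable (K : Type*) [Field K] (R : Type*) [CommRing R] [Algebra K R]
  (D : Type*) [Ring D] [Algebra K D] [Module.Finite K D]

/-- In the coordinates `R ⊗[K] D ≃ R^n` attached to the basis `Module.finBasis K D`
(`ScalarExtension.coordLinearEquiv`), the diagonal image `1 ⊗ d` of `d ∈ D` has coordinates the
images in `R` of the coordinates of `d` (Mathlib `Algebra.TensorProduct.basis_repr_tmul`). [folklore] -/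
theorem ScalarExtension.coordLinearEquiv_incl (d : D) (i : Fin (Module.finrank K D)) :
    ScalarExtension.coordLinearEquiv K R D (ScalarExtension.incl K R D d) i =
      algebraMap K R ((Module.finBasis K D).repr d i) := by
  change (Algebra.TensorProduct.basis R (Module.finBasis K D)).equivFun ((1 : R) ⊗ₜ[K] d) i = _
  rw [Module.Basis.equivFun_apply, Algebra.TensorProduct.basis_repr_tmul, one_smul,
    Finsupp.mapRange_apply]

/-- Every coordinate vector with entries in (the image of) `K` is the coordinate vector of a
lattice point `1 ⊗ d`. [folklore] -/
theorem ScalarExtension.exists_incl_coordLinearEquiv_eq (k : Fin (Module.finrank K D) → K) :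
    ∃ d : D, ScalarExtension.coordLinearEquiv K R D (ScalarExtension.incl K R D d) =
      fun i => algebraMap K R (k i) := by
  refine ⟨(Module.finBasis K D).equivFun.symm k, funext fun i => ?_⟩
  rw [ScalarExtension.coordLinearEquiv_incl]
  congr 1
  have := (Module.finBasis K D).equivFun.apply_symm_apply k
  rw [Module.Basis.equivFun_apply] at this
  exact congrFun this i

end Coordinates

/-! ### Inputs 2 and 3: `D` is discrete and cocompact in `D_𝔸` (Weil, BNT Thm. IV.2) -/

section InputsTwoThree

variable (K : Type) [Field K] [NumberField K] (D : Type*) [Ring D] [Algebra K D]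

/-- **Weil, BNT Thm. IV.2 (discreteness), for every finite-dimensional `D`** — discharge of the
named fact `discreteTopology_rationalLattice`: `D` is discrete in `D_𝔸 = 𝔸_K ⊗_K D`. In coordinates
`D_𝔸 ≅ 𝔸_K^n`, `D ≅ K^n` (`ScalarExtension.coordLinearEquiv_incl`), and `K` is discrete in `𝔸_K`
(`AdeleRing.exists_isOpen_forall_algebraMap_mem_eq_zero`, `AdeleRingTopology`): if `U ∋ 0` is open
in `𝔸_K` without non-zero principal adeles then `U^n` isolates `0` in the lattice. Weil's own
reduction: "E is isomorphic to `kⁿ`, so that, if the theorem is proved for `E = k`, it must be true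
in general". [cite: WeilBNT1967, Ch. IV §2 Thm. 2] -/
theorem discreteTopology_rationalLattice_holds : discreteTopology_rationalLattice K D := by
  intro _
  obtain ⟨U, hU, hU0, hUK⟩ := AdeleRing.exists_isOpen_forall_algebraMap_mem_eq_zero K
  set e := ScalarExtension.coordHomeomorph K (AdeleRing (𝓞 K) K) D with he
  refine AddSubgroup.discreteTopology_of_isOpen_forall_eq_zero _
    ((isOpen_set_pi Set.finite_univ fun _ _ => hU).preimage e.continuous) ?_ ?_
  · simp only [Set.mem_preimage, Set.mem_univ_pi]
    intro i
    rw [ScalarExtension.coordHomeomorph_apply, map_zero]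
    exact hU0
  · rintro _ ⟨d, rfl⟩ hd
    simp only [Set.mem_preimage, Set.mem_univ_pi] at hd
    have hd0 : ∀ i, (Module.finBasis K D).repr d i = 0 := fun i => by
      have := hd i
      rw [ScalarExtension.coordHomeomorph_apply] at this
      change ScalarExtension.coordLinearEquiv K (AdeleRing (𝓞 K) K) D
        (ScalarExtension.incl K (AdeleRing (𝓞 K) K) D d) i ∈ U at this
      rw [ScalarExtension.coordLinearEquiv_incl] at this
      exact hUK _ this
    have : d = 0 := by
      rw [(Module.finBasis K D).ext_elem_iff]
      intro i
      rw [hd0 i, map_zero, Finsupp.zero_apply]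
    change ScalarExtension.incl K (AdeleRing (𝓞 K) K) D d = 0
    rw [this, map_zero]

/-- **Weil, BNT Thm. IV.2 (cocompactness), for every finite-dimensional `D`** — discharge of the
named fact `compactSpace_quotient_rationalLattice`: `D_𝔸 ⧸ D` is compact. In coordinates, if
`𝔸_K = K + C` with `C` compact (`AdeleRing.exists_isCompact_forall_exists_sub_mem`, using the
compactness of the `𝒪_v` from `AdicCompletionCompact`), then `D_𝔸 = D + C^n`.
[cite: WeilBNT1967, Ch. IV §2 Thm. 2] -/
theorem compactSpace_quotient_rationalLattice_holds : compactSpace_quotient_rationalLattice K D := by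
  intro _
  haveI : ∀ v : HeightOneSpectrum (𝓞 K), CompactSpace (v.adicCompletionIntegers K) :=
    compactSpace_adicCompletionIntegers' K
  obtain ⟨C, hC, hcov⟩ := AdeleRing.exists_isCompact_forall_exists_sub_mem K
  set e := ScalarExtension.coordHomeomorph K (AdeleRing (𝓞 K) K) D with he
  refine AddSubgroup.compactSpace_quotient_of_forall_exists_sub_mem _
    ((isCompact_univ_pi fun _ : Fin (Module.finrank K D) => hC).image e.symm.continuous) fun y => ?_
  choose k hk using fun i : Fin (Module.finrank K D) => hcov (e y i)
  obtain ⟨d, hd⟩ := ScalarExtension.exists_incl_coordLinearEquiv_eq K (AdeleRing (𝓞 K) K) D k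
  refine ⟨_, incl_mem_rationalLattice K D d, ⟨e (y - ScalarExtension.incl K (AdeleRing (𝓞 K) K) D d),
    ?_, e.symm_apply_apply _⟩⟩
  simp only [Set.mem_univ_pi]
  intro i
  rw [ScalarExtension.coordHomeomorph_apply, map_sub, hd]
  exact hk i

end InputsTwoThree

/-! ### Input 5: the archimedean module formula on `D_𝔸` -/

section Transport

/-- **Transport of the distributive Haar character** along an equivariant isomorphism: if
`e : A ≃ₜ+ B` is an isomorphism of locally compact abelian topological groups intertwining the
action of `g` on `A` with that of `h` on `B` (`e (g • a) = h • e a`), then `g` and `h` have the same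
module, `Δ_A(g) = Δ_B(h)` (transport of a Haar measure of `B` and of a compact set of positive
measure). [folklore] -/
theorem distribHaarChar_eq_of_continuousAddEquiv {G H A B : Type*} [Group G] [Group H]
    [AddCommGroup A] [DistribMulAction G A] [TopologicalSpace A] [IsTopologicalAddGroup A]
    [LocallyCompactSpace A] [ContinuousConstSMul G A]
    [AddCommGroup B] [DistribMulAction H B] [TopologicalSpace B] [IsTopologicalAddGroup B]
    [LocallyCompactSpace B] [ContinuousConstSMul H B]
    (e : A ≃ₜ+ B) (g : G) (h : H) (he : ∀ a, e (g • a) = h • e a) :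
    distribHaarChar A g = distribHaarChar B h := by
  borelize A B
  set μ : Measure B := addHaar with hμ
  set ν : Measure A := μ.map e.symm with hν
  haveI : ν.IsAddHaarMeasure := e.symm.isAddHaarMeasure_map μ
  haveI : ν.Regular := Regular.map e.symm.toHomeomorph
  have hνS : ∀ S : Set A, ν S = μ (e.symm ⁻¹' S) := fun S =>
    (e.symm.toHomeomorph.toMeasurableEquiv).map_apply S
  -- equivariance for `g⁻¹`
  have he' : ∀ a, e (g⁻¹ • a) = h⁻¹ • e a := fun a => by
    rw [eq_inv_smul_iff, ← he, smul_inv_smul]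
  -- a compact set of positive finite measure in `B`
  obtain ⟨k⟩ := (inferInstance : Nonempty (TopologicalSpace.PositiveCompacts B))
  have hk0 : μ (k : Set B) ≠ 0 :=
    (Measure.measure_pos_of_nonempty_interior _ k.interior_nonempty).ne'
  have hktop : μ (k : Set B) ≠ ∞ := k.isCompact.measure_lt_top.ne
  have h1 : e.symm ⁻¹' (e ⁻¹' (k : Set B)) = k := by
    ext b; simp only [Set.mem_preimage, ContinuousAddEquiv.apply_symm_apply]
  have h2 : e.symm ⁻¹' (g • (e ⁻¹' (k : Set B))) = h • (k : Set B) := by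
    ext b
    simp only [Set.mem_preimage, Set.mem_smul_set_iff_inv_smul_mem, he',
      ContinuousAddEquiv.apply_symm_apply]
  refine distribHaarChar_eq_of_measure_smul_eq_mul (μ := ν) (s := e ⁻¹' (k : Set B))
    (by rw [hνS, h1]; exact hk0) (by rw [hνS, h1]; exact hktop) ?_
  rw [hνS, hνS, h1, h2, distribHaarChar_mul]

end Transport

section InputFive

variable (K : Type) [Field K] [NumberField K]

open scoped Classical in
/-- **Module of a positive real scalar on `𝔸_Kⁿ`.** For a finite index type `ι` and `t > 0`, the
diagonal idele `z(t) = posRealIdele K t` acting coordinatewise on `𝔸_K^ι` scales additive Haar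
measure by `t ^ (#ι · [K:ℚ])`. Same proof as `AdeleRing.distribHaarChar_posRealIdele` (the case
`#ι = 1`): a Haar measure of `𝔸_K^ι = K_∞^ι × (𝔸_K^∞)^ι` sliced along a compact
`C^ι ⊆ (𝔸_K^∞)^ι` is a Haar measure of the real vector space `(ℝ^{r₁} × ℂ^{r₂})^ι` of dimension
`#ι · [K:ℚ]`, on which `t` acts as a real scalar (Mathlib `Measure.addHaar_smul`).
Weil, BNT IV §4, Cor. 2 of Thm. 5 (`|z(λ)|_A = λⁿ`) with IV §1 (`E_A ≅ k_Aⁿ`); Vignéras II §4.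
[cite: WeilBNT1967, Ch. IV §4, Cor. 2 of Thm. 5] -/
theorem AdeleRing.distribHaarChar_pi_posRealIdele [LocallyCompactSpace (AdeleRing (𝓞 K) K)]
    (ι : Type) [Fintype ι] (t : ℝ≥0ˣ) :
    distribHaarChar (ι → AdeleRing (𝓞 K) K)
        (Units.map (Pi.constRingHom ι (AdeleRing (𝓞 K) K)).toMonoidHom (posRealIdele K t)) =
      (t : ℝ≥0) ^ (Fintype.card ι * Module.finrank ℚ K) := by
  borelize (ι → AdeleRing (𝓞 K) K)
  haveI : BorelSpace (ι → mixedEmbedding.mixedSpace K) := inferInstance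
  set μ : Measure (ι → AdeleRing (𝓞 K) K) := addHaar with hμ
  -- a compact `C ⊆ 𝔸_K^∞` with `0` in its interior
  obtain ⟨N, hN, hN0⟩ := exists_compact_mem_nhds (0 : AdeleRing (𝓞 K) K)
  set C : Set (FiniteAdeleRing (𝓞 K) K) := Prod.snd '' N with hC
  have hCc : IsCompact C := hN.image continuous_snd
  have hCint : (0 : FiniteAdeleRing (𝓞 K) K) ∈ interior C :=
    mem_interior.2 ⟨Prod.snd '' interior N, Set.image_mono interior_subset,
      isOpenMap_snd _ isOpen_interior,
      ⟨(0 : AdeleRing (𝓞 K) K), mem_interior_iff_mem_nhds.2 hN0, rfl⟩⟩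
  -- `φ : K_∞ ≃ₜ ℝ^{r₁} × ℂ^{r₂}` and `ψ x = (φ (x i)_∞)_i`
  set φ := infiniteAdeleRingHomeomorph K with hφ
  set ψ : (ι → AdeleRing (𝓞 K) K) → (ι → mixedEmbedding.mixedSpace K) :=
    fun x i => φ (x i).1 with hψ
  have hψc : Continuous ψ :=
    continuous_pi fun i => φ.continuous.comp (continuous_fst.comp (continuous_apply i))
  have hψm : Measurable ψ := hψc.measurable
  -- the sets `ψ⁻¹(S) ∩ (K_∞ × C)^ι`
  set bx : Set (ι → mixedEmbedding.mixedSpace K) → Set (ι → AdeleRing (𝓞 K) K) :=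
    fun S => {x | ψ x ∈ S ∧ ∀ i, (x i).2 ∈ C} with hbx
  -- the sliced measure `ν S = μ (bx S)` on `(ℝ^{r₁} × ℂ^{r₂})^ι`
  set ν : Measure (ι → mixedEmbedding.mixedSpace K) := (μ.restrict (bx Set.univ)).map ψ with hν
  have hνS : ∀ S, MeasurableSet S → ν S = μ (bx S) := by
    intro S hS
    rw [hν, Measure.map_apply hψm hS, Measure.restrict_apply (hψm hS)]
    congr 1
    ext x
    simp only [Set.mem_inter_iff, Set.mem_preimage, hbx, Set.mem_setOf_eq, Set.mem_univ, true_and]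
  -- `ν` is left invariant
  haveI : ν.IsAddLeftInvariant := by
    refine (forall_measure_preimage_add_iff ν).1 fun y S hS => ?_
    rw [hνS _ (measurable_const_add y hS), hνS S hS]
    have : bx ((fun z => y + z) ⁻¹' S) =
        (fun z => (fun i => (show AdeleRing (𝓞 K) K from (φ.symm (y i), 0))) + z) ⁻¹' (bx S) := by
      ext x
      simp only [Set.mem_preimage, hbx, Set.mem_setOf_eq]
      have e1 : ψ ((fun i => (show AdeleRing (𝓞 K) K from (φ.symm (y i), 0))) + x) = y + ψ x := by
        funext i
        change φ (φ.symm (y i) + (x i).1) = y i + φ (x i).1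
        rw [coe_infiniteAdeleRingHomeomorph, map_add, ← coe_infiniteAdeleRingHomeomorph,
          Homeomorph.apply_symm_apply]
      have e2 : ∀ i, (((fun i => (show AdeleRing (𝓞 K) K from (φ.symm (y i), 0))) + x) i).2 =
          (x i).2 := fun i => by
        change 0 + (x i).2 = (x i).2
        rw [zero_add]
      rw [e1]
      simp only [e2]
    rw [this, measure_preimage_add]
  -- the test set: the closed unit ball `B₀` of `(ℝ^{r₁} × ℂ^{r₂})^ι`, and `bx B₀ = (φ⁻¹ B × C)^ι`
  set B₀ : Set (ι → mixedEmbedding.mixedSpace K) := Metric.closedBall 0 1 with hB₀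
  have hB₀c : IsCompact B₀ := isCompact_closedBall _ _
  have hbxB₀ : bx B₀ = Set.pi Set.univ (fun _ : ι => {a : AdeleRing (𝓞 K) K |
      φ a.1 ∈ Metric.closedBall (0 : mixedEmbedding.mixedSpace K) 1 ∧ a.2 ∈ C}) := by
    ext x
    simp only [hbx, Set.mem_setOf_eq, Set.mem_univ_pi, hB₀, mem_closedBall_zero_iff]
    rw [pi_norm_le_iff_of_nonneg zero_le_one]
    exact ⟨fun h i => ⟨h.1 i, h.2 i⟩, fun h => ⟨fun i => (h i).1, fun i => (h i).2⟩⟩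
  have hs₀c : IsCompact (bx B₀) := by
    rw [hbxB₀]
    exact isCompact_univ_pi fun _ =>
      (φ.isCompact_preimage.2 (isCompact_closedBall _ _)).prod hCc
  have hs₀top : μ (bx B₀) ≠ ∞ := hs₀c.measure_lt_top.ne
  have hs₀0 : μ (bx B₀) ≠ 0 := by
    set O : Set (ι → AdeleRing (𝓞 K) K) := Set.pi Set.univ (fun _ : ι => {a : AdeleRing (𝓞 K) K |
      φ a.1 ∈ Metric.ball (0 : mixedEmbedding.mixedSpace K) 1 ∧ a.2 ∈ interior C}) with hO
    have hsub : O ⊆ bx B₀ := by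
      rw [hbxB₀]
      exact Set.pi_mono fun i _ a ha => ⟨Metric.ball_subset_closedBall ha.1, interior_subset ha.2⟩
    have hopen : IsOpen O := isOpen_set_pi Set.finite_univ fun _ _ =>
      (Metric.isOpen_ball.preimage φ.continuous).prod isOpen_interior
    have hne : O.Nonempty := ⟨0, fun i _ => ⟨by
      change φ 0 ∈ Metric.ball (0 : mixedEmbedding.mixedSpace K) 1
      rw [coe_infiniteAdeleRingHomeomorph, map_zero]
      exact Metric.mem_ball_self one_pos, hCint⟩⟩
    exact ((hopen.measure_pos μ hne).trans_le (measure_mono hsub)).ne'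
  have hνB₀ : ν B₀ = μ (bx B₀) := hνS B₀ measurableSet_closedBall
  haveI : ν.IsAddHaarMeasure := by
    refine isAddHaarMeasure_of_isCompact_nonempty_interior ν B₀ hB₀c ?_ ?_ ?_
    · rw [hB₀, interior_closedBall _ one_ne_zero]; exact ⟨0, Metric.mem_ball_self one_pos⟩
    · rw [hνB₀]; exact hs₀0
    · rw [hνB₀]; exact hs₀top
  -- compute the character on `bx B₀`
  refine distribHaarChar_eq_of_measure_smul_eq_mul (μ := μ) hs₀0 hs₀top ?_
  have ht0 : ((t : ℝ≥0) : ℝ) ≠ 0 := NNReal.coe_ne_zero.2 t.ne_zero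
  have hset : Units.map (Pi.constRingHom ι (AdeleRing (𝓞 K) K)).toMonoidHom (posRealIdele K t) •
      bx B₀ = bx (((t : ℝ≥0) : ℝ) • B₀) := by
    ext x
    rw [Set.mem_smul_set_iff_inv_smul_mem, Units.smul_def, smul_eq_mul, ← map_inv, ← map_inv]
    have e1 : ψ (((Units.map (Pi.constRingHom ι (AdeleRing (𝓞 K) K)).toMonoidHom
        (posRealIdele K t⁻¹) : (ι → AdeleRing (𝓞 K) K)ˣ) : ι → AdeleRing (𝓞 K) K) * x) =
        (((t : ℝ≥0) : ℝ))⁻¹ • ψ x := by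
      funext i
      change φ ((((posRealIdele K t⁻¹ : (AdeleRing (𝓞 K) K)ˣ) : AdeleRing (𝓞 K) K) * x i).1) =
        (((t : ℝ≥0) : ℝ))⁻¹ • φ (x i).1
      change φ (((posRealIdele K t⁻¹ : (AdeleRing (𝓞 K) K)ˣ) : AdeleRing (𝓞 K) K).1 * (x i).1) = _
      rw [posRealIdele_fst, infiniteAdeleRingHomeomorph_realToInfiniteAdele_mul,
        Units.val_inv_eq_inv_val, NNReal.coe_inv]
    have e2 : ∀ i, ((((Units.map (Pi.constRingHom ι (AdeleRing (𝓞 K) K)).toMonoidHom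
        (posRealIdele K t⁻¹) : (ι → AdeleRing (𝓞 K) K)ˣ) : ι → AdeleRing (𝓞 K) K) * x) i).2 =
        (x i).2 := fun i => by
      change (((posRealIdele K t⁻¹ : (AdeleRing (𝓞 K) K)ˣ) : AdeleRing (𝓞 K) K) * x i).2 = (x i).2
      change ((posRealIdele K t⁻¹ : (AdeleRing (𝓞 K) K)ˣ) : AdeleRing (𝓞 K) K).2 * (x i).2 = _
      rw [posRealIdele_snd, one_mul]
    simp only [hbx, Set.mem_setOf_eq, e1, e2, Set.mem_smul_set_iff_inv_smul_mem₀ ht0]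
  rw [hset, ← hνS _ (measurableSet_closedBall.const_smul₀ _), Measure.addHaar_smul ν, hνB₀,
    Module.finrank_pi_fintype, Finset.sum_const, Finset.card_univ, smul_eq_mul,
    mixedEmbedding.finrank, abs_pow, NNReal.abs_eq, ENNReal.ofReal_pow (NNReal.coe_nonneg _),
    ENNReal.ofReal_coe_nnreal, ENNReal.coe_pow]

variable (D : Type*) [Ring D] [Algebra K D]

/-- **The archimedean module on `D_𝔸`, for every finite-dimensional `D`** — the module of the
central real scalar `posRealCentral K D t` on `D_𝔸 = 𝔸_K ⊗_K D` is `t ^ ([K:ℚ] · dim_K D)`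
(transport of `AdeleRing.distribHaarChar_pi_posRealIdele` along the `𝔸_K`-linear coordinates
`D_𝔸 ≅ 𝔸_Kⁿ`, `ScalarExtension.coordLinearEquiv`, an isomorphism of topological additive groups). Weil, BNT IV §4, Cor. 2 of Thm. 5 with IV §1; Vignéras II §4, III §1.
[cite: WeilBNT1967, Ch. IV §4, Cor. 2 of Thm. 5] -/
theorem distribHaarChar_posRealCentral [Module.Finite K D] [LocallyCompactSpace (AdeleRing (𝓞 K) K)]
    (t : ℝ≥0ˣ) :
    distribHaarChar (ScalarExtension K (AdeleRing (𝓞 K) K) D) (posRealCentral K D t) =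
      (t : ℝ≥0) ^ (Module.finrank ℚ K * Module.finrank K D) := by
  haveI : T2Space (AdeleRing (𝓞 K) K) := t2Space_adeleRing K
  -- the coordinates `D_𝔸 ≃ 𝔸_Kⁿ` as an isomorphism of topological additive groups
  let e : ScalarExtension K (AdeleRing (𝓞 K) K) D ≃ₜ+ (Fin (Module.finrank K D) → AdeleRing (𝓞 K) K) :=
    { (ScalarExtension.coordLinearEquiv K (AdeleRing (𝓞 K) K) D).toAddEquiv with
      continuous_toFun := (ScalarExtension.coordHomeomorph K (AdeleRing (𝓞 K) K) D).continuous
      continuous_invFun := (ScalarExtension.coordHomeomorph K (AdeleRing (𝓞 K) K) D).symm.continuous }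
  rw [distribHaarChar_eq_of_continuousAddEquiv e (posRealCentral K D t)
    (Units.map (Pi.constRingHom (Fin (Module.finrank K D)) (AdeleRing (𝓞 K) K)).toMonoidHom
      (posRealIdele K t)) ?_, AdeleRing.distribHaarChar_pi_posRealIdele, Fintype.card_fin, mul_comm]
  intro y
  -- `posRealCentral t • y = z • y` for the `𝔸_K`-module structure, `z = posRealIdele K t`
  have h1 : posRealCentral K D t • y = ((posRealIdele K t : (AdeleRing (𝓞 K) K)ˣ) : AdeleRing (𝓞 K) K) • y := by
    rw [Units.smul_def, smul_eq_mul, Algebra.smul_def]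
    rfl
  rw [h1]
  change ScalarExtension.coordLinearEquiv K (AdeleRing (𝓞 K) K) D (_ • y) =
    _ • ScalarExtension.coordLinearEquiv K (AdeleRing (𝓞 K) K) D y
  rw [map_smul, Units.smul_def, smul_eq_mul]
  funext i
  rfl

/-- **Discharge of the named fact `addHaar_posRealCentral_smul`** for every finite-dimensional
`D`: `vol(posRealCentral K D t • s) = t ^ ([K:ℚ] · dim_K D) · vol(s)` for every regular Haar measure
on `D_𝔸` (local compactness of `𝔸_K` from `AdicCompletionCompact`, then
`distribHaarChar_posRealCentral` and Mathlib `distribHaarChar_mul`).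
Weil, BNT IV §4, Cor. 2 of Thm. 5; Vignéras II §4, III §1. [cite: WeilBNT1967, Ch. IV §4, Cor. 2 of Thm. 5] -/
theorem addHaar_posRealCentral_smul_holds : addHaar_posRealCentral_smul K D := by
  intro _ μ _ _ t s
  haveI : ∀ v : HeightOneSpectrum (𝓞 K), CompactSpace (v.adicCompletionIntegers K) :=
    compactSpace_adicCompletionIntegers' K
  haveI : LocallyCompactSpace (AdeleRing (𝓞 K) K) := locallyCompactSpace_adeleRing' K
  haveI : T2Space (AdeleRing (𝓞 K) K) := t2Space_adeleRing K
  rw [← distribHaarChar_mul μ, distribHaarChar_posRealCentral, ENNReal.coe_pow]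

end InputFive

end Literature.NumberTheory.Automorphic
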